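import Literature.Analysis.FluidPDE.KochTataruIntegralOfClass
import Literature.Analysis.FluidPDE.KochTataruSliceBMO
import Literature.Analysis.FluidPDE.KochTataruBilinearEstimate
import Literature.Analysis.FluidPDE.SolenoidalL2Duality
import Literature.Analysis.FunctionSpaces.BMOInvProofs
import HarnessLib

/-!
# (T3) discharged: solutions of Koch–Tataru's integral equation are solutions in Koch–Tataru's class

Analysis/FluidPDE proof companion of `Literature/Analysis/FluidPDE/KochTataru.lean` (the
decomposition of the named fact `Literature.Analysis.FluidPDE.koch_tataru`, **ns.S15**, Koch–Tataru,
Adv. Math. 157 (2001), Theorem 2, into (L1), (L2), (T1)–(T4)). This file **discharges (T3)**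
`isKochTataruSolution_of_integral`: if `u₀` is weakly divergence free, polynomially tempered and in
`BMO⁻¹(E;E)`, and `u` solves Koch–Tataru's integral equation (11) pointwise with `‖u‖_X < ∞`, then
`u` is a solution in Koch–Tataru's class `IsKochTataruSolution u₀ u` — (i) weakly divergence-free
slices, (ii) the duality (very weak) form `Fluid.IsMildNSSolutionFrom 1 0 u₀ u t` for all `t ≥ 0`
(Lemarié-Rieusset 2016, Thm. 6.1, (6.12) ⇒ (6.11)), (iii) measurability, (iv) slices in `BMO⁻¹`
(Koch–Tataru's Theorem 1). No definitions; everything is **proved**: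

* `§ Datum`: `heatExtension_slice_regular` — the free evolution `e^{tΔ}u₀` of a tempered datum is
  strongly measurable, `O((1+‖x‖)^K)` and locally integrable (componentwise from the scalar `BMO`
  cluster);
* `§ BMOAlgebra`: `BMO⁻¹(E; E)` is stable under `-`, `+`, `-` (`MemBMOInvVec.neg'/add'/sub'`, from
  `eBMOSeminorm_const_smul_le` and the discharged `MemBMOInv.add`);
* `§ Assembly`: **(T3-bil)** `memBMOInvVec_kochTataruBilinear` — `B(u,v)(t) ∈ BMO⁻¹` for `u, v` of
  finite Koch–Tataru norm and `t > 0` (`memBMOInvVec_kochTataruBilinear_of_estimate'` of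
  `KochTataruSliceBMO.lean` — the caloric extension of the slice is `B` of the time-truncated fields at
  the later time, whose Carleson boxes the bilinear estimate controls — fed with the discharged (L1)
  `kochTataruBilinear_estimate_holds` of `KochTataruBilinearEstimate.lean`); and the discharge
  **`isKochTataruSolution_of_integral_holds`**: for `t > 0`, `u(t) = e^{tΔ}u₀ - B(u,u)(t)` pointwise,
  (i) from `isWeaklyDivFree_heatExtension` (`KochTataruIntegralOfClass.lean`) and
  `isWeaklyDivFree_kochTataruBilinear` (`KochTataruPairing.lean`), (ii) from the datum symmetry
  `∫⟪e^{tΔ}u₀, φ⟫ = ∫⟪u₀, e^{tΔ}φ⟫` (`integral_inner_heatExtension_eq_of_hasCompactSupport`,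
  `KochTataruIntegralOfClass.lean`) and the tested bilinear term
  `∫⟪B(u,u)(t), φ⟫ = -∫₀ᵗ∫⟪u, (u·∇)e^{(t-τ)Δ}φ⟫`
  (`integral_inner_kochTataruBilinear_eq_neg_intervalIntegral`, `KochTataruPairing.lean`), with
  `u(0) = u₀` at `t = 0`, (iv) from `MemBMOInvVec.heatExtension` (`KochTataruHeatSlice.lean`:
  `e^{tΔ}u₀ ∈ BMO⁻¹`, Theorem 1 both ways), (T3-bil) and `§ BMOAlgebra`. Consequently
  `koch_tataru_of_T4 : (T4) → koch_tataru`.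

## The DAG after this file

`koch_tataru` ⇐ (T4) `integral_of_isKochTataruSolution` alone; (L1) (`kochTataruBilinear_estimate_holds`),
(L2) (`eKochTataruNorm_heatExtension_le_holds`), (T1)–(T2) (`KochTataruFixedPoint.lean`) and (T3)
(this file) are theorems.

## Mathlib / tree search

Tree: `KochTataruPairing.lean` (tested `B`, `isWeaklyDivFree_kochTataruBilinear`, slice bounds),
`KochTataruIntegralOfClass.lean` (`isWeaklyDivFree_heatExtension`,
`integral_inner_heatExtension_eq_of_hasCompactSupport` — the datum lemmas, landed from the (T4) side
while this file was in review; the copies of an earlier version of this file were dropped),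
`KochTataruHeatSlice.lean` (`MemBMOInvVec.heatExtension`; an earlier version of this file carried it
as a named fact (T3-lin) with its own proof, dropped), `KochTataruSliceBMO.lean`
(`memBMOInvVec_kochTataruBilinear_of_estimate'`), `KochTataruBilinearEstimate.lean`
(`kochTataruBilinear_estimate_holds`), `KochTataruLinear.lean` (`IsPolynomiallyTempered.*`,
`heatExtension_eq_sum_heatExtension_inner`, `koch_tataru_of_L1_T3_T4`), the `BMO` cluster
(`exists_unif_bound_heatExtension`, `measurable_heatExtension_section`, `MemBMOInv.add_holds`,
`eBMOSeminorm_const_smul_le`), `SolenoidalL2Duality` (`IsWeaklyDivFree.sub_of_locallyIntegrable`),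
`WeakGradientIBP` (`integrable_inner_of_locallyIntegrable_of_hasCompactSupport`). New here and nowhere
else (`lean search 'slice_regular|MemBMOInvVec.sub|memBMOInvVec_kochTataruBilinear |of_integral_holds'`):
`heatExtension_slice_regular`, the `BMO⁻¹` algebra, (T3-bil) and the discharge. Mathlib:
`Measure.integrableOn_of_bounded`, `locallyIntegrable_iff`.

## References

* H. Koch, D. Tataru, *Well-posedness for the Navier–Stokes equations*, Adv. Math. 157 (2001)
  22–35, Theorems 1–2, §1 (2)–(3), §3 ((11), Lemmas 3.1–3.2). Bib key `KochTataruAdvMath2001`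
  (held: doi:10.1006/aima.2000.1937).
* P. G. Lemarié-Rieusset, *The Navier–Stokes problem in the 21st century*, CRC Press 2016
  (held), Ch. 6, Thm. 6.1 ((6.12) ⇒ (6.11): a solution of the integral equation with the Oseen
  tensor is a very weak solution). Bib key `LemarieRieusset2016`.
-/

noncomputable section

open MeasureTheory Set Function Filter Topology Metric Real TopologicalSpace
open scoped ENNReal NNReal RealInnerProductSpace

namespace Literature.Analysis.FluidPDE

variable {E : Type*} [NormedAddCommGroup E] [InnerProductSpace ℝ E]

/-! ## The free evolution of a tempered datum: regularity of the slices -/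

section Datum

variable [FiniteDimensional ℝ E] [MeasurableSpace E] [BorelSpace E]

/-- Components of a polynomially tempered field have a common polynomial growth:
`(1 + ‖y‖)^{-K} ⟪u₀, v⟫ ∈ L¹` with the `K` of `‖u₀‖`, for every `v` with `‖v‖ ≤ 1`. [folklore] -/
theorem integrable_growth_inner_of_norm {u₀ : E → E} {K : ℕ}
    (hK : Integrable fun y => ((1 + ‖y‖) ^ K)⁻¹ * ‖u₀ y‖) (hu : AEStronglyMeasurable u₀ volume)
    {v : E} (hv : ‖v‖ ≤ 1) :
    Integrable fun y => ((1 + ‖y‖) ^ K)⁻¹ * ⟪u₀ y, v⟫ := by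
  have hcw : Continuous fun y : E => ((1 + ‖y‖) ^ K)⁻¹ :=
    ((continuous_const.add continuous_norm).pow K).inv₀ fun y => by
      show (1 + ‖y‖) ^ K ≠ 0
      positivity
  refine hK.mono' (hcw.aestronglyMeasurable.mul (hu.inner_const)) ?_
  refine Eventually.of_forall fun y => ?_
  rw [norm_mul, Real.norm_of_nonneg (by positivity), Real.norm_eq_abs]
  gcongr
  calc |⟪u₀ y, v⟫| ≤ ‖u₀ y‖ * ‖v‖ := abs_real_inner_le_norm _ _
    _ ≤ ‖u₀ y‖ * 1 := by gcongr
    _ = ‖u₀ y‖ := mul_one _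

/-- **The free evolution of a tempered datum is measurable and locally bounded**: for `t > 0`,
`x ↦ e^{tΔ}u₀(x)` is strongly measurable and `‖e^{tΔ}u₀(x)‖ ≤ C (1 + ‖x‖)^K`, hence locally
integrable (componentwise from the scalar cluster). [folklore] -/
theorem heatExtension_slice_regular {u₀ : E → E} (hu₀ : IsPolynomiallyTempered u₀) {t : ℝ} (ht : 0 < t) :
    StronglyMeasurable (UnboundedOperators.heatExtension u₀ t) ∧
      (∃ C : ℝ, ∃ K : ℕ, 0 ≤ C ∧ ∀ x, ‖UnboundedOperators.heatExtension u₀ t x‖ ≤ C * (1 + ‖x‖) ^ K) ∧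
      LocallyIntegrable (UnboundedOperators.heatExtension u₀ t) volume := by
  set b := stdOrthonormalBasis ℝ E with hb_def
  set d : ℕ := Module.finrank ℝ E with hd
  obtain ⟨K, hK⟩ := hu₀.integrable_growth_norm
  have hu_meas : AEStronglyMeasurable u₀ volume := hu₀.aestronglyMeasurable
  have hbi : ∀ i, ‖b i‖ ≤ 1 := fun i => (b.orthonormal.1 i).le
  set w : Fin d → E → ℝ := fun i z => ⟪u₀ z, b i⟫ with hw
  have hwi : ∀ i, Integrable fun y => ((1 + ‖y‖) ^ K)⁻¹ * w i y := fun i =>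
    integrable_growth_inner_of_norm hK hu_meas (hbi i)
  have hsum : UnboundedOperators.heatExtension u₀ t =
      fun x => ∑ i, FunctionSpaces.BMOInv.heatExtension (w i) t x • b i :=
    funext fun x => heatExtension_eq_sum_heatExtension_inner hu₀ b ht x
  have hmeas : StronglyMeasurable (UnboundedOperators.heatExtension u₀ t) := by
    rw [hsum]
    refine Measurable.stronglyMeasurable (Finset.measurable_sum _ fun i _ => ?_)
    exact (FunctionSpaces.BMOInv.measurable_heatExtension_section (hu_meas.inner_const) t).smul_const _
  obtain ⟨C₁, hC₁0, hC₁⟩ : ∃ C : ℝ, 0 ≤ C ∧ ∀ i, ∀ y : E,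
      |FunctionSpaces.BMOInv.heatExtension (w i) t y| ≤ C * (1 + ‖y‖) ^ K := by
    have hex : ∀ i, ∃ C : ℝ, 0 ≤ C ∧ ∀ y : E,
        |FunctionSpaces.BMOInv.heatExtension (w i) t y| ≤ C * (1 + ‖y‖) ^ K := fun i => by
      obtain ⟨C, hC0, hC⟩ := FunctionSpaces.BMOInv.exists_unif_bound_heatExtension (hwi i) ht le_rfl
      exact ⟨C, hC0, fun y => hC t ⟨le_rfl, le_rfl⟩ y⟩
    choose C hC0 hC using hex
    refine ⟨∑ i, C i, Finset.sum_nonneg fun i _ => hC0 i, fun i y => (hC i y).trans ?_⟩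
    gcongr
    exact Finset.single_le_sum (fun j _ => hC0 j) (Finset.mem_univ i)
  have hbound : ∀ x, ‖UnboundedOperators.heatExtension u₀ t x‖ ≤ (d * C₁) * (1 + ‖x‖) ^ K := by
    intro x
    rw [hsum]
    calc ‖∑ i, FunctionSpaces.BMOInv.heatExtension (w i) t x • b i‖
        ≤ ∑ i, ‖FunctionSpaces.BMOInv.heatExtension (w i) t x • b i‖ := norm_sum_le _ _
      _ ≤ ∑ _i : Fin d, C₁ * (1 + ‖x‖) ^ K := by
          refine Finset.sum_le_sum fun i _ => ?_
          rw [norm_smul, Real.norm_eq_abs]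
          calc |FunctionSpaces.BMOInv.heatExtension (w i) t x| * ‖b i‖
              ≤ C₁ * (1 + ‖x‖) ^ K * 1 := by gcongr <;> [exact hC₁ i x; exact hbi i]
            _ = C₁ * (1 + ‖x‖) ^ K := mul_one _
      _ = (d * C₁) * (1 + ‖x‖) ^ K := by
          rw [Finset.sum_const, Finset.card_univ, Fintype.card_fin, nsmul_eq_mul]; ring
  refine ⟨hmeas, ⟨d * C₁, K, by positivity, hbound⟩, ?_⟩
  -- local integrability: bounded on every compact set
  refine (locallyIntegrable_iff).2 fun k hk => ?_
  obtain ⟨R, hR⟩ := hk.isBounded.subset_closedBall 0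
  refine Measure.integrableOn_of_bounded hk.measure_lt_top.ne hmeas.aestronglyMeasurable
    (M := (d * C₁) * (1 + |R|) ^ K) ?_
  refine (ae_restrict_iff' hk.measurableSet).2 (Eventually.of_forall fun x hx => ?_)
  have hxR : ‖x‖ ≤ |R| := (mem_closedBall_zero_iff.1 (hR hx)).trans (le_abs_self R)
  calc ‖UnboundedOperators.heatExtension u₀ t x‖ ≤ (d * C₁) * (1 + ‖x‖) ^ K := hbound x
    _ ≤ (d * C₁) * (1 + |R|) ^ K := by gcongr

end Datum

/-! ## `BMO⁻¹(E; E)` is a linear space: negation and subtraction -/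

section BMOAlgebra

variable [FiniteDimensional ℝ E] [MeasurableSpace E] [BorelSpace E]

/-- `BMO` is stable under negation (`‖-f‖_* ≤ ‖f‖_*`, Stein IV.1.1). [folklore] -/
theorem _root_.Literature.Analysis.FunctionSpaces.MemBMO.neg' {f : E → ℝ}
    (hf : FunctionSpaces.MemBMO f) : FunctionSpaces.MemBMO (fun x => -f x) := by
  refine ⟨hf.1.neg, ?_⟩
  have h := FunctionSpaces.eBMOSeminorm_const_smul_le (-1 : ℝ) f volume
  have hfun : ((-1 : ℝ) • f) = fun x => -f x := by funext x; simp
  rw [hfun] at h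
  refine h.trans_lt ?_
  exact ENNReal.mul_lt_top (by simp) hf.2

/-- Weak divergence representations are stable under negation: `u = div Φ` weakly implies
`-u = div (-Φ)` weakly. [folklore] -/
theorem _root_.Literature.Analysis.FunctionSpaces.HasWeakDivergenceRepresentation.neg' {u : E → ℝ} {Φ : E → E}
    (hu : FunctionSpaces.HasWeakDivergenceRepresentation u Φ) :
    FunctionSpaces.HasWeakDivergenceRepresentation (fun x => -u x) (fun x => -Φ x) where
  locallyIntegrable := hu.locallyIntegrable.neg
  locallyIntegrable_field := hu.locallyIntegrable_field.neg
  integral_mul_eq φ hφ := by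
    simp only [neg_mul, inner_neg_left, integral_neg, hu.integral_mul_eq φ hφ]

/-- **`BMO⁻¹` is stable under negation** (Koch–Tataru 2001, §1: `BMO⁻¹` is a normed linear
space). [cite: KochTataruAdvMath2001, §1] -/
theorem _root_.Literature.Analysis.FunctionSpaces.MemBMOInv.neg' {u : E → ℝ} (hu : FunctionSpaces.MemBMOInv u) :
    FunctionSpaces.MemBMOInv (fun x => -u x) := by
  obtain ⟨Φ, hΦ, hrep⟩ := hu
  refine ⟨fun x => -Φ x, fun v => ?_, hrep.neg'⟩
  have h : (fun x => ⟪-Φ x, v⟫) = fun x => -⟪Φ x, v⟫ := by funext x; simp [inner_neg_left]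
  rw [h]
  exact (hΦ v).neg'

/-- **`BMO⁻¹(E; E)` is stable under negation** (componentwise). [cite: KochTataruAdvMath2001, §1] -/
theorem _root_.Literature.Analysis.FunctionSpaces.MemBMOInvVec.neg' {u : E → E} (hu : FunctionSpaces.MemBMOInvVec u) :
    FunctionSpaces.MemBMOInvVec (fun x => -u x) := by
  intro v
  have h : (fun x => ⟪-u x, v⟫) = fun x => -⟪u x, v⟫ := by funext x; simp [inner_neg_left]
  rw [h]
  exact (hu v).neg'

/-- **`BMO⁻¹(E; E)` is stable under addition** (componentwise, from the discharged
`MemBMOInv.add`). [cite: KochTataruAdvMath2001, §1] -/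
theorem _root_.Literature.Analysis.FunctionSpaces.MemBMOInvVec.add' {u w : E → E} (hu : FunctionSpaces.MemBMOInvVec u)
    (hw : FunctionSpaces.MemBMOInvVec w) : FunctionSpaces.MemBMOInvVec (fun x => u x + w x) := by
  intro v
  have h : (fun x => ⟪u x + w x, v⟫) = (fun x => ⟪u x, v⟫) + fun x => ⟪w x, v⟫ := by
    funext x; simp [inner_add_left]
  rw [h]
  exact FunctionSpaces.MemBMOInv.add_holds (hu v) (hw v)

/-- **`BMO⁻¹(E; E)` is stable under subtraction** (componentwise). [cite: KochTataruAdvMath2001, §1] -/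
theorem _root_.Literature.Analysis.FunctionSpaces.MemBMOInvVec.sub' {u w : E → E} (hu : FunctionSpaces.MemBMOInvVec u)
    (hw : FunctionSpaces.MemBMOInvVec w) : FunctionSpaces.MemBMOInvVec (fun x => u x - w x) := by
  have h : (fun x => u x - w x) = fun x => u x + (fun y => -w y) x := by
    funext x; simp [sub_eq_add_neg]
  rw [h]
  exact hu.add' hw.neg'

end BMOAlgebra


/-! ## Assembly: discharge of (T3) -/

section Assembly

variable [FiniteDimensional ℝ E] [MeasurableSpace E] [BorelSpace E]

/-- Positive-time slices of `B(u, v)` are locally integrable (bounded and strongly measurable). [folklore] -/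
theorem locallyIntegrable_kochTataruBilinear {u v : ℝ → E → E}
    (hu : AEStronglyMeasurable (uncurry u) ((volume : Measure (ℝ × E)).restrict (Ioi 0 ×ˢ univ)))
    (hv : AEStronglyMeasurable (uncurry v) ((volume : Measure (ℝ × E)).restrict (Ioi 0 ×ˢ univ)))
    (huX : eKochTataruNorm u < ∞) (hvX : eKochTataruNorm v < ∞) {t : ℝ} (ht : 0 < t) :
    LocallyIntegrable (kochTataruBilinear u v t) volume := by
  obtain ⟨B, -, hB⟩ := exists_norm_kochTataruBilinear_le hu hv huX hvX ht
  refine (locallyIntegrable_iff).2 fun k hk => ?_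
  exact Measure.integrableOn_of_bounded hk.measure_lt_top.ne
    (stronglyMeasurable_kochTataruBilinear_slice hu hv t).aestronglyMeasurable
    (Eventually.of_forall hB)

/-- **(T3-bil) Positive-time slices of the bilinear term lie in `BMO⁻¹`** (Koch–Tataru 2001,
Theorem 1 with Lemmas 3.1–3.2: for `u, v ∈ X` the Duhamel term `V∇Π(u ⊗ v)` lies in `X`, whose
slices are in `BMO⁻¹`; here: the caloric extension `e^{sΔ}B(u,v)(t)` is `B` of the fields truncated
to times `< t` at time `t + s` (`heatExtension_kochTataruBilinear`, `KochTataruSliceBMO.lean`), its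
Carleson boxes are controlled by the discharged bilinear estimate (L1)
`kochTataruBilinear_estimate_holds` (`KochTataruBilinearEstimate.lean`), and Theorem 1
(`memBMOInv_iff_carleson_heat_holds`) applies to the bounded slice): for all space–time fields `u`,
`v` measurable on `(0, ∞) × E` with finite Koch–Tataru norms and every `t > 0`,
`B(u, v)(t) = kochTataruBilinear u v t ∈ BMO⁻¹(E; E)`. [cite: KochTataruAdvMath2001, Theorem 1 and Lemma 3.2] -/
theorem memBMOInvVec_kochTataruBilinear {u v : ℝ → E → E}
    (hu : AEStronglyMeasurable (uncurry u) ((volume : Measure (ℝ × E)).restrict (Ioi 0 ×ˢ univ)))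
    (hv : AEStronglyMeasurable (uncurry v) ((volume : Measure (ℝ × E)).restrict (Ioi 0 ×ˢ univ)))
    (huX : eKochTataruNorm u < ∞) (hvX : eKochTataruNorm v < ∞) {t : ℝ} (ht : 0 < t) :
    FunctionSpaces.MemBMOInvVec (kochTataruBilinear u v t) :=
  memBMOInvVec_kochTataruBilinear_of_estimate' kochTataruBilinear_estimate_holds hu hv huX hvX ht

/-- **Discharge of (T3)** `isKochTataruSolution_of_integral` — Koch–Tataru 2001, §3 ("We can rewrite
the Navier–Stokes equation as (11)") with Lemarié-Rieusset 2016, Thm. 6.1, (6.12) ⇒ (6.11) (a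
solution of the integral (Oseen) equation is a very weak solution): a pointwise solution `u` of the
integral equation (11) with `‖u‖_X < ∞`, from a weakly divergence-free, polynomially tempered
`u₀ ∈ BMO⁻¹(E; E)`, is a solution in Koch–Tataru's class `IsKochTataruSolution u₀ u`. Proof: for
`t > 0` the slice is `u(t) = e^{tΔ}u₀ - B(u,u)(t)` pointwise; (i) both terms are weakly divergence
free (`isWeaklyDivFree_heatExtension` of `KochTataruIntegralOfClass.lean`,
`isWeaklyDivFree_kochTataruBilinear` of `KochTataruPairing.lean`); (ii) tested against a
divergence-free test field `φ`, `∫⟪e^{tΔ}u₀, φ⟫ = ∫⟪u₀, e^{tΔ}φ⟫`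
(`integral_inner_heatExtension_eq_of_hasCompactSupport`) and
`∫⟪B(u,u)(t), φ⟫ = -∫₀ᵗ∫⟪u, (u·∇)e^{(t-τ)Δ}φ⟫` (`integral_inner_kochTataruBilinear_eq_neg_intervalIntegral`),
which is the duality identity `Fluid.IsMildNSSolutionFrom 1 0 u₀ u t` (zero force); at `t = 0` it is
`u(0) = u₀`; (iii) the slices lie in `BMO⁻¹`: the free flow by Koch–Tataru's Theorem 1
(`MemBMOInvVec.heatExtension`, `KochTataruHeatSlice.lean`), the bilinear term by (T3-bil)
`memBMOInvVec_kochTataruBilinear`, and `BMO⁻¹` is a linear space (`MemBMOInvVec.sub'`). [cite: LemarieRieusset2016, Thm. 6.1 ((6.12) ⇒ (6.11))] -/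
theorem isKochTataruSolution_of_integral_holds : isKochTataruSolution_of_integral E := by
  intro u₀ u hdiv hmem htemp hint hX
  have hmeas := hint.aestronglyMeasurable
  have hslice : ∀ t, 0 < t →
      u t = fun x => UnboundedOperators.heatExtension u₀ t x - kochTataruBilinear u u t x :=
    fun t ht => funext (hint.integralEq t ht)
  refine ⟨⟨fun t ht => ?_, fun t ht => ?_⟩, hmeas, fun t ht => ?_⟩
  · -- weak divergence freeness of the slices
    rcases (mem_Ici.1 ht).eq_or_lt with rfl | ht'
    · rw [hint.initial]; exact hdiv
    · rw [hslice t ht']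
      exact (isWeaklyDivFree_heatExtension hdiv htemp ht').sub_of_locallyIntegrable
        (isWeaklyDivFree_kochTataruBilinear hmeas hmeas hX hX t)
        (heatExtension_slice_regular htemp ht').2.2
        (locallyIntegrable_kochTataruBilinear hmeas hmeas hX hX ht')
  · -- the duality identity
    rcases (mem_Ici.1 ht).eq_or_lt with rfl | ht'
    · exact isMildNSSolutionFrom_zero_iff.2 fun φ _ _ => by rw [hint.initial]
    · intro φ hφ hdivφ
      have hφc := hφ.hasCompactSupport
      have hφcont := hφ.contDiff.continuous
      have hI1 : Integrable (fun x => ⟪UnboundedOperators.heatExtension u₀ t x, φ x⟫) :=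
        integrable_inner_of_locallyIntegrable_of_hasCompactSupport
          (heatExtension_slice_regular htemp ht').2.2 hφcont hφc
      have hdat := integral_inner_heatExtension_eq_of_hasCompactSupport htemp hφcont hφc ht'
      have hI2 := integrable_inner_kochTataruBilinear hmeas hmeas hX hX ht' hφcont hφc
      have hB := integral_inner_kochTataruBilinear_eq_neg_intervalIntegral hmeas hX ht' hφ hdivφ
      have hzero : ∫ τ in (0 : ℝ)..t, ∫ x, ⟪(0 : ℝ → E → E) τ x, heatTest 1 φ (t - τ) x⟫ = 0 := by
        simp
      rw [hzero, add_zero, hslice t ht']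
      simp only [inner_sub_left]
      rw [integral_sub hI1 hI2, hdat, hB, heatTest_of_pos one_pos ht', one_mul, sub_neg_eq_add]
  · -- the slices lie in `BMO⁻¹`
    rcases ht.eq_or_lt with rfl | ht'
    · rw [hint.initial]; exact hmem
    · rw [hslice t ht']
      exact (hmem.heatExtension htemp ht').sub' (memBMOInvVec_kochTataruBilinear hmeas hmeas hX hX ht')

/-- **Koch–Tataru's Theorem 2 from (T4) alone**: after this file the named fact `koch_tataru`
(**ns.S15**) follows from the converse direction (T4) `integral_of_isKochTataruSolution` ("class
solutions of finite `X`-norm solve the integral equation") alone, (L1), (L2), (T1)–(T3) being theorems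
(`koch_tataru_of_L1_T3_T4` of `KochTataruLinear.lean`; Koch–Tataru 2001, Theorem 2). [cite: KochTataruAdvMath2001, Theorem 2] -/
theorem koch_tataru_of_T4 (hCONV : integral_of_isKochTataruSolution (EuclideanSpace ℝ (Fin 3))) :
    koch_tataru :=
  koch_tataru_of_L1_T3_T4 kochTataruBilinear_estimate_holds isKochTataruSolution_of_integral_holds hCONV

end Assembly

end Literature.Analysis.FluidPDE
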